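import Mathlib
import HarnessLib
import Literature.Computability.AlgebraicComplexity.DegenerationSpectralMonotone
import Summits.MatrixMultiplication.MatrixMultiplication.Theorems.CwSquareDegeneratesToMM223
import Summits.MatrixMultiplication.MatrixMultiplication.Theorems.OutsiderSandwichSubrankSix
import Summits.MatrixMultiplication.MatrixMultiplication.Theorems.OutsiderSandwichMMPlusTwoDegeneration

/-!
# OutsiderSandwich — `⟨7⟩ ⊴₄ cw₂ ⊠ cw₂`: the border subrank of `cw₂^{⊠2}` exceeds its subrank `6`
(decomp-mm lens 4 «minimal-counterexample / extremal reduction», gen 42, kernel K42-e; THESES-FREE;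
definitions = the certificate tables only, as in `OutsiderSandwichMMPlusTwoDegeneration` (K42-d))

Host: the Kronecker square `cw₂ ⊠ cw₂` of the little Coppersmith–Winograd tensor in its defining basis
(format `9³`, support `Φ` = the `36` pairs of `cw₂`-triples).  In kernel before this file (over `ℂ`):
`Q(cw₂^{⊠2}) = 6` — `⟨6⟩ ≤ cw₂^{⊠2}` by zeroing out and `⟨7⟩ ≰ cw₂^{⊠2}`
(`OutsiderSandwichSubrankSix.not_unitTensor_seven_le_cwPow_two`, K39-c: unit slices transported into the
minimal slice layer of `D^{⊠2} ≅ cw₂^{⊠2}`).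

**This file proves, over every commutative ring `R`:**

* `isApproxRestriction` — a COMBINATORIAL degeneration of order `4` in the sense of BCS (15.29)–(15.30):
  a diagonal `Ψ ⊂ Φ` of size `7` (seven host triples with pairwise distinct first, second and third
  coordinates) and non-negative integer weights `a, b, c ≤ 3` on the host coordinates with `a+b+c = 4`
  on `Ψ` and `≥ 5` on every other triple of `Φ` inside the used coordinates; as monomial matrices
  (`ε^{a(u)}` at `(slot of u, u)`, the two unused coordinates of each leg dropped; tables `dT?/dW?`):
  `(A(ε) ⊗ B(ε) ⊗ C(ε))·(cw₂ ⊠ cw₂) = ε⁴·⟨7⟩ + ε⁵·E` (`9` junk terms, all at order `5`).  Found by an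
  exhaustive enumeration (`combdeg7.py`: all `1968` size-7 diagonals of `Φ`, exact LP for the weights —
  `672` are combinatorial degenerations, the least order is `4`; NO size-8 diagonal of `Φ` is one, and —
  basis dependence — NO size-7 diagonal of the support of `D^{⊠2}` is one), verified independently
  (`verify_u7.py`) and here by `decide` over `ℤ` on the five coefficient layers (`cert`).
* `unitTensor_seven_deg_cwTwoPow_two` — `⟨7⟩ ⊴ cw₂^{⊠2}` (`AlgDegeneratesTo (kroneckerPow (cwTensor R 2) 2)
  (unitTensor R 7)`); instance over `ℂ`.
* `subrank_lt_border_subrank_cwPow_two` (over `ℂ`) — **`⟨7⟩` is a degeneration but not a restriction of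
  `cw₂^{⊠2}`**: the border subrank of the Kronecker square of `T_{cw,2}` is at least `7` while its subrank
  is `6` (K39).  Since `Q̲(cw₂) = 2` (`cw₂ ≅ D` is polystable and not a unit tensor), border subrank is
  strictly super-multiplicative on this square as well (`7 > 4`; informal remark, not restated).

Census reading (decomp-mm lens 4; `LaserTangency`, stmt-32268, is instrumented by RESTRICTION tables):
the `N = 2` diagonal cell reads `6` by restriction and `≥ 7` by degeneration (`8` has no combinatorial
certificate in either basis; `9` is excluded by polystable rigidity, K33).  Together with K42-d
(`⟨2,2,2⟩ ⊕ ⟨2⟩ ⊴₄ cw₂^{⊠2}` against `⟨2,2,2⟩ ⊕ ⟨1⟩ ≤`, `2⟨2,2,2⟩ ≰`) the whole `N = 2` row of the census now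
separates the two orders.  Coppersmith–Winograd-type constructions live in the degeneration order and pay
the conversion to restrictions at `o(N)` exponent; at `N = 2` the price is visible and exact.

References: [cite: BurgisserClausenShokrollahi1997, (15.19), (15.29), (15.30)];
[cite: CoppersmithWinograd1990, §6–7]; [cite: ChristandlVranaZuiddam2023, §1.1]; [cite: Blaser2013, §6].
-/

set_option linter.dupNamespace false

namespace Summit.MatrixMultiplication.MatrixMultiplication.Theorems.OutsiderSandwichBorderSubrankSeven

open scoped BigOperators Polynomial
open Literature.Computability.AlgebraicComplexity
open Summit.MatrixMultiplication.MatrixMultiplication.Theorems.CwSquareDegeneratesToMM223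
  (intCast_cwSq kroneckerPow_two_restrictsTo)
open Summit.MatrixMultiplication.MatrixMultiplication.Theorems.OutsiderSandwichMMPlusTwoDegeneration
  (coeff_mono_term)

/-! ## The certificate (host coordinate `(a₁,a₂) ∈ Fin 3 × Fin 3`; target codes `Fin 8`, `7` = dropped) -/

/-- target code of a diagonal point. [new] -/
def code (x : Fin 7) : Fin 8 := x.castSucc

/-- slot-1 map: host coordinate ↦ target code (`7` = dropped). [new] -/
def dTA : Fin 3 → Fin 3 → Fin 8 := ![![7, 0, 1], ![2, 3, 7], ![4, 5, 6]]
/-- slot-1 weights (powers of `ε`). [new] -/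
def dWA : Fin 3 → Fin 3 → ℕ := ![![0, 3, 3], ![3, 3, 0], ![0, 2, 0]]
/-- slot-2 map. [new] -/
def dTB : Fin 3 → Fin 3 → Fin 8 := ![![5, 7, 2], ![0, 3, 1], ![6, 4, 7]]
/-- slot-2 weights. [new] -/
def dWB : Fin 3 → Fin 3 → ℕ := ![![2, 0, 0], ![1, 1, 0], ![2, 3, 0]]
/-- slot-3 map. [new] -/
def dTC : Fin 3 → Fin 3 → Fin 8 := ![![3, 4, 6], ![1, 0, 2], ![7, 5, 7]]
/-- slot-3 weights. [new] -/
def dWC : Fin 3 → Fin 3 → ℕ := ![![0, 1, 2], ![1, 0, 1], ![0, 0, 0]]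

variable (R : Type) [CommRing R]

/-- the polynomial matrix `A(ε)`: entry `ε^{w}` at `(dTA a, a)` for kept `a`, else `0`. [new] -/
noncomputable def mA (x : Fin 7) (a : Fin 3 × Fin 3) : R[X] :=
  if dTA a.1 a.2 = code x then Polynomial.C (1 : R) * Polynomial.X ^ dWA a.1 a.2 else 0
/-- the polynomial matrix `B(ε)`. [new] -/
noncomputable def mB (y : Fin 7) (b : Fin 3 × Fin 3) : R[X] :=
  if dTB b.1 b.2 = code y then Polynomial.C (1 : R) * Polynomial.X ^ dWB b.1 b.2 else 0
/-- the polynomial matrix `C(ε)`. [new] -/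
noncomputable def mC (z : Fin 7) (c : Fin 3 × Fin 3) : R[X] :=
  if dTC c.1 c.2 = code z then Polynomial.C (1 : R) * Polynomial.X ^ dWC c.1 c.2 else 0

/-- the `ε^n`-coefficient contributed by the host triple `(a,b,c)` to the target entry `(x,y,z)`,
over `ℤ`. [new] -/
def fT (n : ℕ) (x y z : Fin 7) (a b c : Fin 3 × Fin 3) : ℤ :=
  if dTA a.1 a.2 = code x ∧ dTB b.1 b.2 = code y ∧ dTC c.1 c.2 = code z ∧
      n = dWA a.1 a.2 + dWB b.1 b.2 + dWC c.1 c.2 then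
    kroneckerTensor (cwTensor ℤ 2) (cwTensor ℤ 2) a b c
  else 0

/-- the same coefficient summed over the host, with the slot tests hoisted (fast to `decide`). [new] -/
def cS (n : ℕ) (x y z : Fin 7) : ℤ :=
  ∑ a : Fin 3 × Fin 3, if dTA a.1 a.2 = code x then
    (∑ b : Fin 3 × Fin 3, if dTB b.1 b.2 = code y then ∑ c : Fin 3 × Fin 3, fT n x y z a b c else 0)
  else 0

/-! ## Bookkeeping -/

/-- the `ε^n`-coefficient of one summand is the cast of `fT`. [new] -/
theorem coeff_term (n : ℕ) (x y z : Fin 7) (a b c : Fin 3 × Fin 3) :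
    (mA R x a * mB R y b * mC R z c *
        Polynomial.C (kroneckerTensor (cwTensor R 2) (cwTensor R 2) a b c)).coeff n =
      ((fT n x y z a b c : ℤ) : R) := by
  rw [mA, mB, mC, coeff_mono_term, fT]
  split_ifs with h
  · rw [one_mul, one_mul, one_mul, intCast_cwSq]
  · simp

/-- flat triple sum `=` hoisted sum. [new] -/
theorem flat_eq (n : ℕ) (x y z : Fin 7) :
    ∑ a : Fin 3 × Fin 3, ∑ b : Fin 3 × Fin 3, ∑ c : Fin 3 × Fin 3, fT n x y z a b c = cS n x y z := by
  unfold cS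
  refine Finset.sum_congr rfl fun a _ => ?_
  split_ifs with ha
  · refine Finset.sum_congr rfl fun b _ => ?_
    split_ifs with hb
    · rfl
    · exact Finset.sum_eq_zero fun c _ => by simp [fT, hb]
  · exact Finset.sum_eq_zero fun b _ => Finset.sum_eq_zero fun c _ => by simp [fT, ha]

/-- cast `ℤ → R` of the unit tensor. [folklore] -/
theorem intCast_unitTensor (n : ℕ) (x y z : Fin n) :
    ((unitTensor ℤ n x y z : ℤ) : R) = unitTensor R n x y z := by
  unfold unitTensor; split_ifs <;> simp

set_option maxRecDepth 8000 in
set_option maxHeartbeats 2000000 in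
/-- **The certificate over `ℤ`**: the `ε⁰ … ε³` layers vanish and the `ε⁴` layer is `⟨7⟩`, for all
`343` target entries, by `decide`. [new] -/
theorem cert : ∀ (n : Fin 5) (x y z : Fin 7),
    cS n x y z = if (n : ℕ) = 4 then unitTensor ℤ 7 x y z else 0 := by
  intro n x
  fin_cases n <;> fin_cases x <;> decide

/-! ## The degeneration -/

/-- **`(A(ε) ⊗ B(ε) ⊗ C(ε))·(cw₂ ⊠ cw₂) = ε⁴·⟨7⟩ + O(ε⁵)`** — a (combinatorial) degeneration of order `4`
in the sense of BCS (15.19)/(15.30), over every commutative ring. [new] -/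
theorem isApproxRestriction :
    IsApproxRestriction 4 (kroneckerTensor (cwTensor R 2) (cwTensor R 2)) (unitTensor R 7)
      (mA R) (mB R) (mC R) := by
  intro x y z n hn
  simp only [Polynomial.finsetSum_coeff, coeff_term]
  have hsum : (∑ a : Fin 3 × Fin 3, ∑ b : Fin 3 × Fin 3, ∑ c : Fin 3 × Fin 3,
      ((fT n x y z a b c : ℤ) : R)) = ((cS n x y z : ℤ) : R) := by
    rw [← flat_eq]; push_cast; rfl
  have hc := cert ⟨n, by omega⟩ x y z
  rw [hsum, hc]
  split_ifs with h4
  · exact intCast_unitTensor R 7 x y z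
  · simp

/-- **`⟨7⟩ ⊴ cw₂ ⊠ cw₂`**. [new] -/
theorem algDegeneratesTo_cwSq :
    AlgDegeneratesTo (kroneckerTensor (cwTensor R 2) (cwTensor R 2)) (unitTensor R 7) :=
  ⟨4, _, _, _, isApproxRestriction R⟩

/-- **`⟨7⟩ ⊴ cw₂^{⊠2}`** (`kroneckerPow (cwTensor R 2) 2`), over any commutative ring `R`. [new] -/
theorem unitTensor_seven_deg_cwTwoPow_two :
    AlgDegeneratesTo (kroneckerPow (cwTensor R 2) 2) (unitTensor R 7) :=
  (kroneckerPow_two_restrictsTo R _).algDegeneratesTo_trans (algDegeneratesTo_cwSq R)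

/-- `⟨7⟩ ⊴ cw₂^{⊠2}` over `ℂ`. [new] -/
theorem unitTensor_seven_deg_cwTwoPow_two_complex :
    AlgDegeneratesTo (kroneckerPow (cwTensor ℂ 2) 2) (unitTensor ℂ 7) :=
  unitTensor_seven_deg_cwTwoPow_two ℂ

/-- **Subrank `<` border subrank for `cw₂^{⊠2}`** (over `ℂ`): `⟨7⟩` is NOT a restriction of the
Kronecker square of `T_{cw,2}` (K39-c, `Q(cw₂^{⊠2}) = 6`) but IS a degeneration of it (order `4`). [new] -/
theorem subrank_lt_border_subrank_cwPow_two :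
    ¬ TensorRestrictsTo (kroneckerPow (cwTensor ℂ 2) 2) (unitTensor ℂ 7) ∧
      AlgDegeneratesTo (kroneckerPow (cwTensor ℂ 2) 2) (unitTensor ℂ 7) :=
  ⟨OutsiderSandwichSubrankSix.not_unitTensor_seven_le_cwPow_two, unitTensor_seven_deg_cwTwoPow_two_complex⟩

end Summit.MatrixMultiplication.MatrixMultiplication.Theorems.OutsiderSandwichBorderSubrankSeven
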